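import Summits.Ventures.PercRepro.RankLevelSetBiIndepAbsorbNormSkew
import Summits.Ventures.PercRepro.RankLevelSetBiIndepTruncate

/-! # RankLevelSetBiIndepAbsorbTruncate — (ABS-norm) SURVIVES EVERY TRUNCATION (night-1 g32; dossier §44.2)

In the truncation `T_k M` (independent = `M`-independent with at most `k` elements, g24's `truncateTo`) the
bi-independent sets are the window `#E − k ≤ level ≤ k` of those of `M`, and a set absorbs `x` in `T_k M` iff it
absorbs `x` in `M` or sits at the top level `k` (where `insert x Z` has `k + 1` elements). So the absorbing avoid-`x`
profile of `T_k M` is the absorbing profile of `M` on the window below `k`, and at least it at level `k`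
(**`lowAbsorbAt_truncateTo_of_lt`**, **`lowAbsorbAt_subset_truncateTo`**, **`lowAbsorbAt_truncateTo_eq_empty`**).
Every comparison of the normalized half rule in `T_k M` with a nonzero left side has both levels inside the window,
its right side at most `k`, and is either a comparison of `M` or one whose right side only grew:
**`absorbNormSkew_truncateTo : BiIndepAbsorbNormSkew M → BiIndepAbsorbNormSkew (truncateTo M k)`** — no hypothesis on
`M` beyond (ABS-norm) itself. With `RankLevelSetBiIndepAbsorbNormSkewSum`, `…Parallel` and `…Paving`, (ABS-norm) holds
on the closure of the paving matroids under direct sums (with Mono of the summands), truncations and parallel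
extensions — the class of g31's NHR — and in particular (★★)⁺ is a theorem there. Every declaration has a docstring;
imports: the cell's own modules and Mathlib only. Axioms: standard. -/

namespace PercRepro

open Set Matroid

variable {α : Type} (M : Matroid α) [M.Finite]

/-- Below the top level the absorbing avoid-`x` sets of `T_k M` are those of `M` (inside the window). -/
lemma lowAbsorbAt_truncateTo_of_lt (x : α) {k j : ℕ} (hj : j + 1 ≤ k) (hw : M.E.ncard - j ≤ k) :
    haveI := truncateTo_finite M k
    lowAbsorbAt (truncateTo M k) x j = lowAbsorbAt M x j := by
  haveI := truncateTo_finite M k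
  ext Z
  simp only [lowAbsorbAt, Set.mem_setOf_eq, mem_biIndep_truncateTo_iff, truncateTo_indep_iff]
  constructor
  · rintro ⟨⟨hZ, -, -⟩, hxZ, hdep⟩
    refine ⟨hZ, hxZ, fun hind => hdep ⟨hind, ?_⟩⟩
    have hZfin : Z.Finite := M.ground_finite.subset hZ.1
    rw [Set.ncard_insert_of_notMem hxZ hZfin, hZ.2.1]
    exact hj
  · rintro ⟨hZ, hxZ, hdep⟩
    exact ⟨⟨hZ, by omega, hw⟩, hxZ, fun hind => hdep hind.1⟩

/-- At the top level `k` every absorbing avoid-`x` set of `M` (inside the window) absorbs `x` in `T_k M`. -/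
lemma lowAbsorbAt_subset_truncateTo (x : α) {k : ℕ} (hw : M.E.ncard - k ≤ k) :
    haveI := truncateTo_finite M k
    lowAbsorbAt M x k ⊆ lowAbsorbAt (truncateTo M k) x k := by
  haveI := truncateTo_finite M k
  rintro Z ⟨hZ, hxZ, hdep⟩
  simp only [lowAbsorbAt, Set.mem_setOf_eq, mem_biIndep_truncateTo_iff, truncateTo_indep_iff]
  exact ⟨⟨hZ, le_rfl, hw⟩, hxZ, fun hind => hdep hind.1⟩

/-- Outside the window `T_k M` has no absorbing avoid-`x` set. -/
lemma lowAbsorbAt_truncateTo_eq_empty (x : α) {k j : ℕ} (h : ¬ (j ≤ k ∧ M.E.ncard - j ≤ k)) :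
    haveI := truncateTo_finite M k
    lowAbsorbAt (truncateTo M k) x j = ∅ := by
  haveI := truncateTo_finite M k
  rw [Set.eq_empty_iff_forall_notMem]
  rintro Z ⟨hZ, -, -⟩
  rw [mem_biIndep_truncateTo_iff] at hZ
  exact h ⟨hZ.2.1, hZ.2.2⟩

/-- **(ABS-norm) SURVIVES TRUNCATION**: `BiIndepAbsorbNormSkew M → BiIndepAbsorbNormSkew (T_k M)`. -/
theorem absorbNormSkew_truncateTo (h : BiIndepAbsorbNormSkew M) (k : ℕ) :
    haveI := truncateTo_finite M k
    BiIndepAbsorbNormSkew (truncateTo M k) := by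
  haveI := truncateTo_finite M k
  intro x hx i j hij hR
  rw [truncateTo_E] at hx hR ⊢
  by_cases hi : lowAbsorbCount (truncateTo M k) x i = 0
  · rw [hi, Nat.zero_mul]; exact Nat.zero_le _
  · -- level `i` is inside the window
    have hwin : i ≤ k ∧ M.E.ncard - i ≤ k := by
      by_contra hcon
      apply hi
      unfold lowAbsorbCount
      rw [lowAbsorbAt_truncateTo_eq_empty M x hcon, Set.ncard_empty]
    have hjk : j ≤ k := by omega
    have hAi : lowAbsorbCount (truncateTo M k) x i = lowAbsorbCount M x i := by
      unfold lowAbsorbCount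
      rw [lowAbsorbAt_truncateTo_of_lt M x (by omega) hwin.2]
    rw [hAi]
    have hM := h x hx i j hij hR
    rcases Nat.lt_or_ge j k with hjlt | hjge
    · have hAj : lowAbsorbCount (truncateTo M k) x j = lowAbsorbCount M x j := by
        unfold lowAbsorbCount
        rw [lowAbsorbAt_truncateTo_of_lt M x (by omega) (by omega)]
      rw [hAj]; exact hM
    · have hjk' : j = k := by omega
      have hle : lowAbsorbCount M x j ≤ lowAbsorbCount (truncateTo M k) x j := by
        unfold lowAbsorbCount
        rw [hjk']
        exact Set.ncard_le_ncard (lowAbsorbAt_subset_truncateTo M x (by omega)) (lowAbsorbAt_finite _ x k)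
      exact hM.trans (Nat.mul_le_mul_right _ hle)

end PercRepro
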